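/-
Copyright (c) 2026 the pub-hodgecm-mathlib formalisation cell (harness21).  Prover seat hodgecm-mathlib-K2E3-p32 (g0), HCML Track B «K2-LIT» (close-out strike line L4
`stub_StCharTS`), h413 = `stmt-HodgeConjecture-24833`, line `K2_E3_EllipticInputs`, unit U4 «Keys», PART «U4Keys» socket :155 (U4f-χ₁-ram-one-d0B)
`sig_K2E3KeysThmTwoContractingRamifiedCharOneDepthZeroNormTrivial` (LINE-LEAD K2E3-plan (g4) EMIT #5, deal D162, cell «U4-RAM»; plan of record K2E3-p06 (g4) DESIGN-M2-v2 (O2)∕(O3),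
step Z2-B), CM part: THE DEPTH-ZERO LEVEL LETTER `(C, hCo, hθC)` OF ★ `K2E3IwahoriTypeBasisMackey` ON `U(Φ₃)(L⁺_v)` — an OPEN subgroup `C ≤ I` on which the Iwahori character
`θ(g) = χ₁(g₀₀)` is `1` (`χ₁` trivial on principal units).  2026-09-04.
-/
import Summits.HodgeConjecture.HodgeConjecture.Theorems.K2E3BranchATypeLettersCM     -- ★ Z2A-3c (iii) (K2E3-p06 (g4)): brings ★ Z2A-3b (`coe_eA_apply`, `isUnit_apply_zero_zero_of_mem`, `map_mem_inf_of_mem`), ★ Z2A-1 (`v_mul_apply_zero_zero_sub_lt_one`), ★ `isOpen_isCompact_levels`, the frame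
import HarnessLib

/-!
# K2 ∕ E3 «EllipticInputs», unit U4 «Keys» — (U4f-χ₁-ram-one-d0B) step Z2-B, CM part: THE DEPTH-ZERO LEVEL LETTER ON `U(Φ₃)(L⁺_v)`
# «`C := {g ∈ I : |(g₀₀)_w − 1|_w < 1}` is an OPEN subgroup and `θ = 1` on `C` when `χ₁` is trivial on the principal units»   [MoyPrasad1996 §3; Roche1998 §3; BruhatTits1972 (4.4.4)]

Cell `pub/hodgecm-mathlib`, crux H413 = `stmt-HodgeConjecture-24833`, route of record `HCCMUnconditional`; chair K2-lead (g2), LINE-LEAD∕dealer K2E3-plan (g4), architect K2E3-p25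
(g3); cell «U4-RAM».  THEOREMS ONLY (no `def`, no `instance`, no `notation`, no named-fact hypothesis, no `sorry`); lane `--supports stmt-HodgeConjecture-24833 --as helper`,
count-neutral.  NOT THE PAYER: the socket :155 stays OPEN.

THE POINT.  ★ `K2E3IwahoriTypeBasisMackey.exists_normalised_typeBasis[_of_fin_two]` (this seat) needs, besides the compatibilities `hθH` (★ p06) and `hθw` (★∕📤
`K2E3BranchBTypeLettersCM`, this seat), an OPEN subgroup `C` with `θ = 1` on `C` — this makes the line `ℂ_θ` a SMOOTH representation of the Iwahori `I`, so that MACKEY applies.  At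
depth zero (`hdepth`: `χ₁(u) = 1` whenever `|u_{w′} − 1| < 1` for all `w′`) the natural `C` is the first congruence layer of the Iwahori read on the `(0,0)` entry:
`C := {g ∈ I : |((eA g)₀₀) − 1|_w < 1}` (print: `I₊ ⊆ C ⊆ I`).  It is a SUBGROUP because on `I` the `(0,0)` entry is multiplicative modulo `𝔭` (★ Z2A-1
`v_mul_apply_zero_zero_sub_lt_one`: `|(jj′)₀₀ − j₀₀j′₀₀| < 1`, `|j₀₀| = 1` ★ `v_apply_zero_zero_eq_one_of_mem_inf`) and the ultrametric inequality; it is OPEN because `I` is (★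
`isOpen_isCompact_levels`) and `g ↦ (eA g)₀₀` is continuous into the valued field `L_w`, where `{x : |x − 1| < 1}` is open (Mathlib `Valued.isOpen_ball`); and `θ(g) = χ₁(g₀₀) = 1` on it
by `hdepth` (`(g₀₀)_w = (eA g)₀₀` ★ `coe_eA_apply`; one place over `v`).  No subgroup is DEFINED: the statement is an existence (`∃ C, IsOpen C ∧ C ≤ I ∧ θ = 1 on C`).
* §1 ultrametric lemmas `v_mul_sub_one_lt_one`, `v_sub_one_lt_one_of_v_sub_mul_lt_one`, `v_sub_one_lt_one_of_inv`.
* §2 **`exists_isOpen_subgroup_theta_eq_one`** — the letter `(C, hCo, hθC)` (with `C ≤ I`).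
HONEST LABEL.  HC_CM is proved only modulo the 7 printed citations (2 remaining named inputs: hLiu418 = `stmt-HodgeConjecture-24832`, h413 = `stmt-HodgeConjecture-24833`) until rung 0
closes; count-neutral — this file does NOT pay the leaf; no printed citation is discharged.

## References
* [MoyPrasad1996] A. Moy, G. Prasad, Comment. Math. Helv. 71 (1996), §3 (depth-zero types; `I₊`).
* [Roche1998] A. Roche, Ann. Sci. ÉNS (4) 31 (1998), §3 (the character `χ̃` of the type on `J`).
* [BruhatTits1972] F. Bruhat, J. Tits, Publ. Math. IHÉS 41 (1972), (4.4.4) (the Iwahori subgroup and its congruence filtration).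
* [Casselman1995] W. Casselman, *Introduction to the theory of admissible representations of `p`-adic reductive groups* (1995), §1.4.
-/

set_option autoImplicit false
-- the mandated namespace has the single-problem summit's repeated segment (`HodgeConjecture.HodgeConjecture`)
set_option linter.dupNamespace false

noncomputable section

open NumberField IsDedekindDomain
open scoped Matrix MatrixGroups WithZero Valued
open Literature.NumberTheory Literature.NumberTheory.Automorphic Literature.NumberTheory.Automorphic.UnitaryGroup
open Literature.NumberTheory.Rogawski1990

namespace Summit.HodgeConjecture.HodgeConjecture.Cruxes.H413.K2E3BranchBPrincipalLevelCM

open Summit.HodgeConjecture.HodgeConjecture.Cruxes.H413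
open Summit.HodgeConjecture.HodgeConjecture.Cruxes.H413.K2E3DepthZeroIwahoriCharacterCM
open Summit.HodgeConjecture.HodgeConjecture.Cruxes.H413.K2E3BranchATorusWitnessCM

variable (L : Type) [Field L] [NumberField L] [IsCMField L] (v : HeightOneSpectrum (𝓞 ↥(maximalRealSubfield L)))
  (w : PlacesOver L v) (hw : IsCMField.complexConj L • w.1 = w.1)
  (eA : Gqs L v ≃ₜ* ↥(unitaryGroupOfForm (galAdicCompletionMap (L := L) (IsCMField.complexConj L) hw) ((StdForm.antidiagonal 3).over (w.1.adicCompletion L))))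
  (heA : ∀ g : Gqs L v,
    ((eA g : ↥(unitaryGroupOfForm (galAdicCompletionMap (L := L) (IsCMField.complexConj L) hw) ((StdForm.antidiagonal 3).over (w.1.adicCompletion L)))) :
        GL (Fin 3) (w.1.adicCompletion L)) =
      ((localNonsplitEquiv (IsCMField.complexConj L) (qsForm L) (IsCMField.complexConj_ne_one L) w hw g :
        ↥(unitaryGroupOfForm (galAdicCompletionMap (L := L) (IsCMField.complexConj L) hw) (placeForm (qsForm L) w.1))) : GL (Fin 3) (w.1.adicCompletion L)))
  {ϖ : w.1.adicCompletion L} (hϖ : Valued.v ϖ = WithZero.exp (-1 : ℤ))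
  (g₁ : GL (Fin 3) (w.1.adicCompletion L)) (hg₁ : (g₁ : Matrix (Fin 3) (Fin 3) (w.1.adicCompletion L)) = Matrix.diagonal ![(1 : w.1.adicCompletion L), 1, ϖ])
  (K0 K1 I : Subgroup (Gqs L v))
  (hK0 : K0 = ((glInt 3 (w.1.adicCompletion L)).subgroupOf
    (unitaryGroupOfForm (galAdicCompletionMap (L := L) (IsCMField.complexConj L) hw) ((StdForm.antidiagonal 3).over (w.1.adicCompletion L)))).comap
      eA.toMulEquiv.toMonoidHom)
  (hK1 : K1 = (((glInt 3 (w.1.adicCompletion L)).map (MulAut.conj g₁).toMonoidHom).subgroupOf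
    (unitaryGroupOfForm (galAdicCompletionMap (L := L) (IsCMField.complexConj L) hw) ((StdForm.antidiagonal 3).over (w.1.adicCompletion L)))).comap
      eA.toMulEquiv.toMonoidHom)
  (hI : I = K0 ⊓ K1)

/-! ## §1 Ultrametric bookkeeping around `1` -/

/-- `|a − 1| < 1`, `|b − 1| < 1` ⟹ `|ab − 1| < 1` (`ab − 1 = (a − 1)b + (b − 1)`, `|b| = 1`). [cite: Casselman1995, §1.4] -/
theorem v_mul_sub_one_lt_one {K : Type*} [Field K] [Valued K ℤᵐ⁰] {a b : K} (ha : Valued.v (a - 1) < 1) (hb : Valued.v (b - 1) < 1) :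
    Valued.v (a * b - 1) < 1 := by
  have hb1 : Valued.v b = 1 := by
    have h : b = 1 + (b - 1) := by ring
    rw [h, Valued.v.map_add_eq_of_lt_left] <;> rw [Valuation.map_one]
    exact hb
  rw [show a * b - 1 = (a - 1) * b + (b - 1) by ring]
  refine Valued.v.map_add_lt ?_ hb
  rw [map_mul, hb1, mul_one]; exact ha

/-- `|c − ab| < 1`, `|ab − 1| < 1` ⟹ `|c − 1| < 1`. [cite: Casselman1995, §1.4] -/
theorem v_sub_one_lt_one_of_v_sub_mul_lt_one {K : Type*} [Field K] [Valued K ℤᵐ⁰] {a b c : K} (hc : Valued.v (c - a * b) < 1) (hab : Valued.v (a * b - 1) < 1) :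
    Valued.v (c - 1) < 1 := by
  rw [show c - 1 = (c - a * b) + (a * b - 1) by ring]
  exact Valued.v.map_add_lt hc hab

/-- `|ab − 1| < 1`, `|b − 1| < 1` ⟹ `|a − 1| < 1` (`a − 1 = (ab − 1)b⁻¹ + (b⁻¹ − 1)`, `|b| = 1`). [cite: Casselman1995, §1.4] -/
theorem v_sub_one_lt_one_of_inv {K : Type*} [Field K] [Valued K ℤᵐ⁰] {a b : K} (hab : Valued.v (a * b - 1) < 1) (hb : Valued.v (b - 1) < 1) :
    Valued.v (a - 1) < 1 := by
  have hb1 : Valued.v b = 1 := by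
    have h : b = 1 + (b - 1) := by ring
    rw [h, Valued.v.map_add_eq_of_lt_left] <;> rw [Valuation.map_one]
    exact hb
  have hb0 : b ≠ 0 := fun h0 => by rw [h0, map_zero] at hb1; exact zero_ne_one hb1
  have hbinv : Valued.v b⁻¹ = 1 := by rw [map_inv₀, hb1, inv_one]
  rw [show a - 1 = (a * b - 1) * b⁻¹ + (b⁻¹ - 1) by field_simp; ring]
  refine Valued.v.map_add_lt ?_ ?_
  · rw [map_mul, hbinv, mul_one]; exact hab
  · rw [show b⁻¹ - 1 = b⁻¹ * (1 - b) by field_simp, map_mul, hbinv, one_mul, Valuation.map_sub_swap]; exact hb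

/-! ## §2 The depth-zero level letter `(C, hCo, hθC)` -/

open Classical in
include hw heA hϖ hg₁ hK0 hK1 hI in
set_option maxHeartbeats 1600000 in
set_option synthInstance.maxHeartbeats 400000 in
-- the `U(Φ₃)(L⁺_v)`-valued products are read in two definitionally equal carriers (`Gqs L v` and the matrix subgroup); unification is slow (class of ★ Z2A-3c (ii))
/-- **THE DEPTH-ZERO LEVEL LETTER.**  For `χ₁ : (L ⊗ L⁺_v)ˣ → ℂˣ` trivial on the principal units (`hdepth`, depth zero) there is an OPEN subgroup `C ≤ I` of `U(Φ₃)(L⁺_v)` on which the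
Iwahori character `θ(g) = χ₁(g₀₀)` (the `dif`-function of ★ Z2A-5) equals `1`: `C = {g ∈ I : |(eA g)₀₀ − 1|_w < 1}` (a subgroup by ★ Z2A-1 and §1; open by ★ `isOpen_isCompact_levels`,
continuity of the `(0,0)` entry along `eA`, Mathlib `Valued.isOpen_ball`).  These are the binders `(C) (hCo) (hθC)` of ★ `K2E3IwahoriTypeBasisMackey.exists_normalised_typeBasis[_of_fin_two]`
for `Ind_P^{U(Φ₃)(L⁺_v)} (χ₁, 1)δ^{1∕2}` with `K = I`. [cite: MoyPrasad1996, §3] [cite: Roche1998, §3] [cite: BruhatTits1972, (4.4.4)] -/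
theorem exists_isOpen_subgroup_theta_eq_one (χ₁ : (LocalRing L v)ˣ →* ℂˣ)
    (hdepth : ∀ u : (LocalRing L v)ˣ, (∀ w' : PlacesOver L v, Valued.v (((u : LocalRing L v) w') - 1) < 1) → χ₁ u = 1) :
    ∃ C : Subgroup (Gqs L v), IsOpen (C : Set (Gqs L v)) ∧ C ≤ I ∧
      ∀ c ∈ C, (if h : IsUnit (((c.val : GL (Fin 3) (LocalRing L v)) : Matrix (Fin 3) (Fin 3) (LocalRing L v)) 0 0) then ((χ₁ h.unit : ℂˣ) : ℂ) else 0) = 1 := by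
  have hvσ : ∀ x, Valued.v (galAdicCompletionMap (L := L) (IsCMField.complexConj L) hw x) = Valued.v x :=
    fun x => valued_galAdicCompletionMap (L := L) (IsCMField.complexConj L) hw x
  -- the `(0,0)` entry along `eA`
  let e : Gqs L v → w.1.adicCompletion L := fun g =>
    (((eA g : ↥(unitaryGroupOfForm (galAdicCompletionMap (L := L) (IsCMField.complexConj L) hw) ((StdForm.antidiagonal 3).over (w.1.adicCompletion L)))) :
      GL (Fin 3) (w.1.adicCompletion L)) : Matrix (Fin 3) (Fin 3) (w.1.adicCompletion L)) 0 0
  have he : ∀ g, e g = (((eA g : ↥(unitaryGroupOfForm (galAdicCompletionMap (L := L) (IsCMField.complexConj L) hw) ((StdForm.antidiagonal 3).over (w.1.adicCompletion L)))) :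
      GL (Fin 3) (w.1.adicCompletion L)) : Matrix (Fin 3) (Fin 3) (w.1.adicCompletion L)) 0 0 := fun _ => rfl
  have he_mul : ∀ g h : Gqs L v, Valued.v (e (g * h) - e g * e h) < 1 ∨ ¬ (g ∈ I ∧ h ∈ I) := by
    intro g h
    by_cases hgh : g ∈ I ∧ h ∈ I
    · left
      have hm := K2E3DepthZeroIwahoriCharacter.v_mul_apply_zero_zero_sub_lt_one (galAdicCompletionMap (L := L) (IsCMField.complexConj L) hw) rfl hvσ hϖ g₁ hg₁
        (map_mem_inf_of_mem L v w hw eA g₁ K0 K1 I hK0 hK1 hI hgh.1) (map_mem_inf_of_mem L v w hw eA g₁ K0 K1 I hK0 hK1 hI hgh.2)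
      rw [← map_mul] at hm
      exact hm
    · right; exact hgh
  have he_one : e 1 = 1 := by rw [he, map_one, OneMemClass.coe_one, Units.val_one, Matrix.one_apply_eq]
  -- the subgroup `C`
  let C : Subgroup (Gqs L v) :=
    { carrier := {g | g ∈ I ∧ Valued.v (e g - 1) < 1}
      mul_mem' := fun {g} {h} hg hh => by
        refine ⟨I.mul_mem hg.1 hh.1, ?_⟩
        rcases he_mul g h with hm | hm
        · exact v_sub_one_lt_one_of_v_sub_mul_lt_one hm (v_mul_sub_one_lt_one hg.2 hh.2)
        · exact absurd ⟨hg.1, hh.1⟩ hm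
      one_mem' := ⟨I.one_mem, by rw [he_one, sub_self, map_zero]; exact zero_lt_one⟩
      inv_mem' := fun {g} hg => by
        refine ⟨I.inv_mem hg.1, ?_⟩
        rcases he_mul g⁻¹ g with hm | hm
        · rw [inv_mul_cancel, he_one, Valuation.map_sub_swap] at hm
          exact v_sub_one_lt_one_of_inv hm hg.2
        · exact absurd ⟨I.inv_mem hg.1, hg.1⟩ hm }
  have hCmem : ∀ g : Gqs L v, g ∈ C ↔ g ∈ I ∧ Valued.v (e g - 1) < 1 := fun _ => Iff.rfl
  refine ⟨C, ?_, fun g hg => ((hCmem g).1 hg).1, fun c hc => ?_⟩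
  · -- `C = I ∩ e⁻¹' {x : |x − 1| < 1}` is open
    have hlev := F0P3cStCharTSStLevelsTransport.isOpen_isCompact_levels L v w hw eA g₁ K0 K1 I hK0 hK1 hI
    have hcont : Continuous e :=
      (Units.continuous_val.comp (continuous_subtype_val.comp eA.continuous)).matrix_elem 0 0
    have hball : IsOpen {x : w.1.adicCompletion L | Valued.v (x - 1) < 1} := by
      have h1 : IsOpen {x : w.1.adicCompletion L | Valued.v x < 1} := by
        simpa only [Valuation.restrict_lt_one_iff] using Valued.isOpen_ball (w.1.adicCompletion L) 1
      exact h1.preimage (continuous_id.sub continuous_const)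
    have hset : (C : Set (Gqs L v)) = (I : Set (Gqs L v)) ∩ e ⁻¹' {x : w.1.adicCompletion L | Valued.v (x - 1) < 1} := by
      ext g; exact hCmem g
    rw [hset]
    exact hlev.2.2.1.inter (hball.preimage hcont)
  · -- `θ(c) = χ₁(c₀₀) = 1`
    obtain ⟨hcI, hcv⟩ := (hCmem c).1 hc
    have hU : IsUnit (((c.val : GL (Fin 3) (LocalRing L v)) : Matrix (Fin 3) (Fin 3) (LocalRing L v)) 0 0) :=
      isUnit_apply_zero_zero_of_mem L v w hw eA heA hϖ g₁ hg₁ K0 K1 I hK0 hK1 hI hcI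
    rw [dif_pos hU]
    have h1 : χ₁ hU.unit = 1 := by
      refine hdepth hU.unit fun w' => ?_
      rw [PlacesOver.eq_of_smul_eq (IsCMField.complexConj L) (IsCMField.complexConj_ne_one L) w hw w', IsUnit.unit_spec,
        ← coe_eA_apply L v w hw eA heA c 0 0]
      exact hcv
    rw [h1, Units.val_one]

end Summit.HodgeConjecture.HodgeConjecture.Cruxes.H413.K2E3BranchBPrincipalLevelCM

end
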